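import Summits.ResolutionOfSingularities.ResolutionOfSingularities.Theorems.HilbertSamuelEliminationSigmaMaxModificationsCorridor3WLadderSegmentsTowerEnds
import HarnessLib

/-!
# [OURS · L1 W4.2] THE UNIT TOWER, REPAIRED: compression WITHIN THE UNIT only (`unitTowerU`), under (H-emp) restricted to the unit (`HEmpU`)
# (crux `SigmaMaxModifications` stmt-ResolutionOfSingularities-18506; conjunct `SigmaMaxModificationsCorridor3` stmt-…-19249; line `w_ladder`; U-seg
# repair of `…SegmentsTower` / `…SegmentsTowerEnds`)

Stub worker res-L1-w42-stub-1 (gen 4). Helper file `--supports stmt-ResolutionOfSingularities-19249 --as helper`; kernel only, no named fact.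

WHY. The gen-3 unit tower `Seg.unitTower b` compresses the localised tower at `x_b` along ALL later stages that are not blown up at their marked
point, which requires their localised centres to be EMPTY forever (`Seg.HEmp b`, all `n`). Beyond the unit based at `b` this is false in
general: sibling near points over `x_b` (a finite near locus `{y₁, y₂}`) evolve independently under the label strategy, and a step treating
a `ν`-line over `y₂` while the marked point (over `y₁`, newer label) waits has a centre meeting the near locus over `x_b`. CJS Def. 6.38 only
concerns the stages of the unit. REPAIR: the gap function `relGapU` keeps EVERY stage after the unit (gap `0` from rank `relLen` on), so the
compressed tower `unitTowerU` needs empty skipped centres only inside the unit — `HEmpU b`: «for `n <` the relative index of the next blown-up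
isolated stage, a waiting step's localised centre is empty», which `…SegmentsHEmp` (p527103) PROVES from the geometric inputs (Dich)/(RegN).
The stages `≤ unitLen` of `unitTowerU` are those of the gen-3 tower (same indices, `relIdxU_eq_of_le`); all generic data of CJS Def. 6.38
(`…SegmentsTower` §3, `…SegmentsTowerEnds`) are re-derived verbatim for `unitTowerU` here and in `…SegmentsTowerEndsU`.

* §1 `Seg.relGapU`, `Seg.relIdxU`, `Seg.nextBaseU`, `Seg.segBaseU` and their arithmetic (agreement with the gen-3 objects up to the unit length).
* §2 `Seg.HEmpU`, `Seg.unitTowerU`, `Seg.termPtU`, unfoldings, and the setting data (local initial stage, `KeySetting`, (F1), isolation of the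
  initial point, permissible centres).

OURS bookkeeping; NOT a statement of the manuscript [Hironaka2017] nor of [CossartJannsenSaito2020]. AI-written; AI review is weaker than expert
review.

References: V. Cossart, U. Jannsen, S. Saito, LNM 2270 (2020), Def. 6.38, Def. 6.39, p. 107 [CossartJannsenSaito2020].
-/

noncomputable section

set_option linter.dupNamespace false -- namespace `…Corridor3.Moving` re-enters `…Corridor3` (module convention of the Moving files)

open CategoryTheory AlgebraicGeometry TopologicalSpace Topology IsLocalRing
open Literature.AlgebraicGeometry.Resolution Literature.RingTheory.HilbertSamuel
open Literature.AlgebraicGeometry.CossartJannsenSaito2020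
open Summit.ResolutionOfSingularities.ResolutionOfSingularities.Theorems.CampaignW42
open Summit.ResolutionOfSingularities.ResolutionOfSingularities.Theorems.SigmaMaxModificationsCorridor3.Helpers

namespace Summit.ResolutionOfSingularities.ResolutionOfSingularities.Theorems.SigmaMaxModificationsCorridor3.Moving.Seg

universe u

/-! ## §1. The gap function keeping every stage after the unit -/

section Cut

variable {B G : ℕ → Prop}

/-- [OURS] THE REPAIRED GAP FUNCTION of the segment based at `m`: the gen-3 gaps `relGap m k` for the ranks `k < relLen m` (inside the unit), and
`0` from the unit's terminal rank on (every later stage is kept; nothing is required of it). [cite: CossartJannsenSaito2020, Def. 6.38] -/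
def relGapU (hB : ∀ n, ∃ m, n ≤ m ∧ B m) (hBG : ∀ n, ∃ m, n ≤ m ∧ B m ∧ G m) (m : ℕ) (k : ℕ) : ℕ :=
  if k < relLen hB hBG m then relGap hB m k else 0

/-- [OURS] The relative index of the `k`-th kept stage for the repaired gaps. [folklore] -/
abbrev relIdxU (hB : ∀ n, ∃ m, n ≤ m ∧ B m) (hBG : ∀ n, ∃ m, n ≤ m ∧ B m ∧ G m) (m k : ℕ) : ℕ :=
  BlowupTower.cidx 0 (relGapU hB hBG m) k

/-- Inside the unit the repaired gaps are the gen-3 gaps. [folklore] -/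
theorem relGapU_of_lt (hB : ∀ n, ∃ m, n ≤ m ∧ B m) (hBG : ∀ n, ∃ m, n ≤ m ∧ B m ∧ G m) (m : ℕ) {k : ℕ} (hk : k < relLen hB hBG m) :
    relGapU hB hBG m k = relGap hB m k :=
  if_pos hk

/-- After the unit the repaired gaps vanish. [folklore] -/
theorem relGapU_of_le (hB : ∀ n, ∃ m, n ≤ m ∧ B m) (hBG : ∀ n, ∃ m, n ≤ m ∧ B m ∧ G m) (m : ℕ) {k : ℕ} (hk : relLen hB hBG m ≤ k) :
    relGapU hB hBG m k = 0 :=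
  if_neg (not_lt.mpr hk)

/-- **Up to the unit length the kept indices are the gen-3 ones**: `relIdxU m k = relIdx m k` for `k ≤ relLen m`. [folklore] -/
theorem relIdxU_eq_of_le (hB : ∀ n, ∃ m, n ≤ m ∧ B m) (hBG : ∀ n, ∃ m, n ≤ m ∧ B m ∧ G m) (m : ℕ) :
    ∀ {k : ℕ}, k ≤ relLen hB hBG m → relIdxU hB hBG m k = relIdx hB m k
  | 0, _ => rfl
  | k + 1, hk => by
    have ih : BlowupTower.cidx 0 (relGapU hB hBG m) k = BlowupTower.cidx 0 (relGap hB m) k :=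
      relIdxU_eq_of_le hB hBG m (Nat.le_of_succ_le hk)
    show BlowupTower.cidx 0 (relGapU hB hBG m) k + relGapU hB hBG m k + 1 = BlowupTower.cidx 0 (relGap hB m) k + relGap hB m k + 1
    rw [ih, relGapU_of_lt hB hBG m (Nat.lt_of_succ_le hk)]

/-- The kept stages of rank `≤ relLen` are blown up (for a blown-up base). [folklore] -/
theorem B_add_relIdxU (hB : ∀ n, ∃ m, n ≤ m ∧ B m) (hBG : ∀ n, ∃ m, n ≤ m ∧ B m ∧ G m) {m : ℕ} (hm : B m) {k : ℕ}
    (hk : k ≤ relLen hB hBG m) : B (m + relIdxU hB hBG m k) := by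
  rw [relIdxU_eq_of_le hB hBG m hk]; exact B_add_relIdx hB hm k

/-- **The skipped stages are not blown up** (the shape of `htriv` for `BlowupTower.compress` with the repaired gaps). [folklore] -/
theorem not_B_add_relIdxU_add (hB : ∀ n, ∃ m, n ≤ m ∧ B m) (hBG : ∀ n, ∃ m, n ≤ m ∧ B m ∧ G m) (m : ℕ) {k j : ℕ}
    (hj : j < relGapU hB hBG m k) : ¬ B (m + (relIdxU hB hBG m k + j + 1)) := by
  by_cases hk : k < relLen hB hBG m
  · rw [relIdxU_eq_of_le hB hBG m hk.le]
    rw [relGapU_of_lt hB hBG m hk] at hj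
    exact not_B_add_relIdx_add hB m hj
  · rw [relGapU_of_le hB hBG m (not_lt.mp hk)] at hj
    exact absurd hj (Nat.not_lt_zero j)

/-- The skipped stages lie inside the unit: `relIdxU k + j + 1 < relIdxU relLen` for `j < relGapU k`. [folklore] -/
theorem relIdxU_add_lt (hB : ∀ n, ∃ m, n ≤ m ∧ B m) (hBG : ∀ n, ∃ m, n ≤ m ∧ B m ∧ G m) (m : ℕ) {k j : ℕ} (hj : j < relGapU hB hBG m k) :
    relIdxU hB hBG m k + j + 1 < relIdxU hB hBG m (relLen hB hBG m) := by
  by_cases hk : k < relLen hB hBG m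
  · calc relIdxU hB hBG m k + j + 1 < relIdxU hB hBG m k + relGapU hB hBG m k + 1 := by omega
      _ = relIdxU hB hBG m (k + 1) := (BlowupTower.cidx_succ 0 _ k).symm
      _ ≤ relIdxU hB hBG m (relLen hB hBG m) := (BlowupTower.cidx_strictMono 0 _).monotone (Nat.succ_le_of_lt hk)
  · rw [relGapU_of_le hB hBG m (not_lt.mp hk)] at hj
    exact absurd hj (Nat.not_lt_zero j)

/-- [OURS] THE BASE OF THE NEXT SEGMENT, repaired indexing: `m + relIdxU m (relLen m)` (numerically the gen-3 `nextBase m`, `nextBaseU_eq`).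
[cite: CossartJannsenSaito2020, Def. 6.39] -/
def nextBaseU (hB : ∀ n, ∃ m, n ≤ m ∧ B m) (hBG : ∀ n, ∃ m, n ≤ m ∧ B m ∧ G m) (m : ℕ) : ℕ :=
  m + relIdxU hB hBG m (relLen hB hBG m)

/-- `nextBaseU = nextBase`. [folklore] -/
theorem nextBaseU_eq (hB : ∀ n, ∃ m, n ≤ m ∧ B m) (hBG : ∀ n, ∃ m, n ≤ m ∧ B m ∧ G m) (m : ℕ) :
    nextBaseU hB hBG m = nextBase hB hBG m := by
  unfold nextBaseU nextBase
  rw [relIdxU_eq_of_le hB hBG m le_rfl]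

/-- The terminal stage of the segment is a cut stage. [folklore] -/
theorem G_nextBaseU (hB : ∀ n, ∃ m, n ≤ m ∧ B m) (hBG : ∀ n, ∃ m, n ≤ m ∧ B m ∧ G m) (m : ℕ) : G (nextBaseU hB hBG m) := by
  rw [nextBaseU_eq]; exact G_nextBase hB hBG m

/-- The terminal stage of the segment is blown up (for a blown-up base). [folklore] -/
theorem B_nextBaseU (hB : ∀ n, ∃ m, n ≤ m ∧ B m) (hBG : ∀ n, ∃ m, n ≤ m ∧ B m ∧ G m) {m : ℕ} (hm : B m) : B (nextBaseU hB hBG m) := by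
  rw [nextBaseU_eq]; exact B_nextBase hB hBG hm

/-- `m < nextBaseU m`. [folklore] -/
theorem lt_nextBaseU (hB : ∀ n, ∃ m, n ≤ m ∧ B m) (hBG : ∀ n, ∃ m, n ≤ m ∧ B m ∧ G m) (m : ℕ) : m < nextBaseU hB hBG m := by
  rw [nextBaseU_eq]; exact lt_nextBase hB hBG m

open Classical in
/-- [OURS] THE BASES OF THE CONSECUTIVE SEGMENTS, repaired indexing: `m_0` the least stage with `B ∧ G`, `m_{i+1} = nextBaseU m_i`.
[cite: CossartJannsenSaito2020, Def. 6.39] -/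
def segBaseU (hB : ∀ n, ∃ m, n ≤ m ∧ B m) (hBG : ∀ n, ∃ m, n ≤ m ∧ B m ∧ G m) : ℕ → ℕ
  | 0 => Nat.find (hBG 0)
  | i + 1 => nextBaseU hB hBG (segBaseU hB hBG i)

/-- Unfolding: `m_{i+1} = nextBaseU m_i`. [folklore] -/
theorem segBaseU_succ (hB : ∀ n, ∃ m, n ≤ m ∧ B m) (hBG : ∀ n, ∃ m, n ≤ m ∧ B m ∧ G m) (i : ℕ) :
    segBaseU hB hBG (i + 1) = nextBaseU hB hBG (segBaseU hB hBG i) := rfl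

open Classical in
/-- Every base is blown up and is a cut stage. [folklore] -/
theorem B_and_G_segBaseU (hB : ∀ n, ∃ m, n ≤ m ∧ B m) (hBG : ∀ n, ∃ m, n ≤ m ∧ B m ∧ G m) :
    ∀ i, B (segBaseU hB hBG i) ∧ G (segBaseU hB hBG i)
  | 0 => (Nat.find_spec (hBG 0)).2
  | i + 1 => ⟨B_nextBaseU hB hBG (B_and_G_segBaseU hB hBG i).1, G_nextBaseU hB hBG _⟩

/-- Every base is blown up. [folklore] -/
theorem B_segBaseU (hB : ∀ n, ∃ m, n ≤ m ∧ B m) (hBG : ∀ n, ∃ m, n ≤ m ∧ B m ∧ G m) (i : ℕ) : B (segBaseU hB hBG i) :=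
  (B_and_G_segBaseU hB hBG i).1

/-- Every base is a cut stage. [folklore] -/
theorem G_segBaseU (hB : ∀ n, ∃ m, n ≤ m ∧ B m) (hBG : ∀ n, ∃ m, n ≤ m ∧ B m ∧ G m) (i : ℕ) : G (segBaseU hB hBG i) :=
  (B_and_G_segBaseU hB hBG i).2

end Cut

/-! ## §2. The repaired unit tower -/

section Unit

variable {R : ∀ S : Scheme.{u}, CentreSeq S → Prop} {N : ℕ} {ν : ℕ → ℕ} {k : Type u} [Field k]
  {c : ℕ → MarkedStage.{u}} (hc : ∀ n, CanonicalNearStep R N ν (c n) (c (n + 1))) (hRa : OracleAdmissible R)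
  (hν : ν ≠ iterPSum N Phi) (h0 : Helpers.CycleInv k N ν (c 0)) (hgen : ∀ n, ∃ m, n ≤ m ∧ (c m).IsBlownUp R N ν)
  (hBG : ∀ n, ∃ m, n ≤ m ∧ (c m).IsBlownUp R N ν ∧ Iso N (c m))

/-- [OURS] **(H-emp) WITHIN THE UNIT based at `b`**: the localised centre of every stage `b + n` of the unit — `n` below the relative index of the
next blown-up isolated stage — that is NOT blown up at its marked point is EMPTY. (The gen-3 `Seg.HEmp` asked this for all `n`; see the module
docstring.) [cite: CossartJannsenSaito2020, Def. 6.38 (iii), Rem. 6.29 (1)] -/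
def HEmpU (b : ℕ) : Prop :=
  ∀ n, n < Seg.relIdxU hgen hBG b (Seg.relLen hgen hBG b) → ¬ (c (b + n)).IsBlownUp R N ν → (locTower hc hRa hν h0 b).C n = ∅

/-- Under (H-emp)U, the stages skipped by the repaired gap function have empty localised centres (`htriv` of `BlowupTower.compress`). [folklore] -/
theorem htriv_of_hEmpU {b : ℕ} (hemp : HEmpU hc hRa hν h0 hgen hBG b) :
    ∀ q j, j < Seg.relGapU hgen hBG b q → (locTower hc hRa hν h0 b).C (BlowupTower.cidx 0 (Seg.relGapU hgen hBG b) q + j + 1) = ∅ :=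
  fun q _ hj => hemp _ (Seg.relIdxU_add_lt hgen hBG b hj) (Seg.not_B_add_relIdxU_add hgen hBG b (k := q) hj)

/-- [OURS] **THE REPAIRED UNIT TOWER BASED AT `b`**: the localised tower at `x_b` compressed along the waiting stages OF THE UNIT (every later
stage kept). Its stages of rank `≤ unitLen` are the blown-up stages `b = g_0 < g_1 < ⋯ < g_m` of the unit read on the local scheme at `x_b`.
[cite: CossartJannsenSaito2020, Def. 6.38, p. 107] -/
def unitTowerU (b : ℕ) (hemp : HEmpU hc hRa hν h0 hgen hBG b) : BlowupTower.{u} :=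
  (locTower hc hRa hν h0 b).compress 0 (Seg.relGapU hgen hBG b) (htriv_of_hEmpU hc hRa hν h0 hgen hBG hemp)

/-- [OURS] The relative index of the terminal stage, repaired indexing: `b + termIdxU b = Seg.nextBaseU b`. [folklore] -/
abbrev termIdxU (b : ℕ) : ℕ :=
  Seg.relIdxU hgen hBG b (unitLen hgen hBG b)

/-- THE terminal marked point `x_{b'}`, `b' = nextBaseU b`, is reached by the localised tower at `x_b`. [cite: CossartJannsenSaito2020, p. 107] -/
theorem exists_termPtU (b : ℕ) : ∃ y : (locTower hc hRa hν h0 b).X (termIdxU hgen hBG b),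
    (locι hc hRa hν h0 b (termIdxU hgen hBG b)).base y = (c (b + termIdxU hgen hBG b)).pt :=
  (upTower hc hRa hν h0 b).mem_range_bcι_localize_of_phi_eq (c b).pt _ _ (upTower_phi_pt hc hRa hν h0 b _)

/-- [OURS] THE TERMINAL POINT of the repaired unit tower: the point of the localised terminal stage over `x_{b'}`. [cite: CossartJannsenSaito2020, Def. 6.38 (vi)] -/
def termPtU (b : ℕ) (hemp : HEmpU hc hRa hν h0 hgen hBG b) : (unitTowerU hc hRa hν h0 hgen hBG b hemp).X (unitLen hgen hBG b) :=
  Classical.choose (exists_termPtU hc hRa hν h0 hgen hBG b)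

/-- The terminal point lies over `x_{b'}`, `b' = Seg.nextBaseU b`. [cite: CossartJannsenSaito2020, Def. 6.38 (vi)] -/
theorem locι_termPtU (b : ℕ) (hemp : HEmpU hc hRa hν h0 hgen hBG b) :
    (locι hc hRa hν h0 b (termIdxU hgen hBG b)).base (termPtU hc hRa hν h0 hgen hBG b hemp) = (c (Seg.nextBaseU hgen hBG b)).pt :=
  Classical.choose_spec (exists_termPtU hc hRa hν h0 hgen hBG b)

/-! ### Unfoldings -/

/-- The initial stage of the repaired unit tower is `Spec 𝒪_{X_b,x_b}`. [cite: CossartJannsenSaito2020, p. 107] -/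
theorem unitTowerU_X_zero (b : ℕ) (hemp : HEmpU hc hRa hν h0 hgen hBG b) :
    (unitTowerU hc hRa hν h0 hgen hBG b hemp).X 0 = Spec ((c b).W.presheaf.stalk (c b).pt) := rfl

/-- The stages of the repaired unit tower are localised stages. [folklore] -/
theorem unitTowerU_X (b : ℕ) (hemp : HEmpU hc hRa hν h0 hgen hBG b) (q : ℕ) :
    (unitTowerU hc hRa hν h0 hgen hBG b hemp).X q = (locTower hc hRa hν h0 b).X (Seg.relIdxU hgen hBG b q) := rfl

/-- The centres of the repaired unit tower are localised centres. [folklore] -/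
theorem unitTowerU_C (b : ℕ) (hemp : HEmpU hc hRa hν h0 hgen hBG b) (q : ℕ) :
    (unitTowerU hc hRa hν h0 hgen hBG b hemp).C q = (locTower hc hRa hν h0 b).C (Seg.relIdxU hgen hBG b q) := rfl

/-! ### The setting of the repaired unit tower -/

/-- **The initial stage is LOCAL at the initial point.** [cite: CossartJannsenSaito2020, p. 107] -/
theorem isLocalAt_unitTowerU (b : ℕ) (hemp : HEmpU hc hRa hν h0 hgen hBG b) :
    IsLocalAt ((unitTowerU hc hRa hν h0 hgen hBG b hemp).X 0) (basePt hc hRa hν h0 b) :=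
  (upTower hc hRa hν h0 b).isLocalAt_localize_zero (c b).pt

/-- **`KeySetting` for the repaired unit tower.** [cite: CossartJannsenSaito2020, p. 107] -/
theorem keySetting_unitTowerU (b : ℕ) (hemp : HEmpU hc hRa hν h0 hgen hBG b) : KeySetting (unitTowerU hc hRa hν h0 hgen hBG b hemp) N := by
  have h := (upTower hc hRa hν h0 b).keySetting_localize (c b).pt N (keySetting_upTower hc hRa hν h0 b)
  exact ⟨h.1, h.2⟩

/-- **(F1) for the repaired unit tower** from (F1) at `x_b ∈ X_b`. [cite: CossartJannsenSaito2020, Thm. 10.2, p. 107] -/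
theorem charHypothesis_unitTowerU (b : ℕ) (hemp : HEmpU hc hRa hν h0 hgen hBG b) (h : CharHypothesis (c b).W (c b).pt) :
    CharHypothesis ((unitTowerU hc hRa hν h0 hgen hBG b hemp).X 0) (basePt hc hRa hν h0 b) :=
  (upTower hc hRa hν h0 b).charHypothesis_localize (c b).pt h

/-- **Isolation of the initial point in the Hilbert–Samuel locus of the (local) initial stage** from isolation of `x_b` in its `ν`-stratum.
[cite: CossartJannsenSaito2020, Def. 13.3, Thm. 2.33 (1)] -/
theorem isIsolatedInHSMaxLocus_unitTowerU (b : ℕ) (hemp : HEmpU hc hRa hν h0 hgen hBG b)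
    (hsc : ∀ y : (c b).W, y ⤳ (c b).pt → Scheme.hsFun (c b).W N y ≤ Scheme.hsFun (c b).W N (c b).pt)
    (hU : ∃ U : Set (c b).W, IsOpen U ∧ (c b).pt ∈ U ∧ U ∩ Scheme.hsStratum (c b).W N (Scheme.hsFun (c b).W N (c b).pt) ⊆ {(c b).pt}) :
    @IsIsolatedInHSMaxLocus ((unitTowerU hc hRa hν h0 hgen hBG b hemp).X 0) ((unitTowerU hc hRa hν h0 hgen hBG b hemp).ln 0) N
      (basePt hc hRa hν h0 b) :=
  isIsolatedInHSMaxLocus_localize_of_stratumIsolated (upTower hc hRa hν h0 b) (c b).pt N hsc hU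

/-- **The centres of the repaired unit tower are permissible.** [cite: CossartJannsenSaito2020, Def. 3.1, Lemma 5.34 (3)] -/
theorem isPermissible_centreIdeal_unitTowerU (b : ℕ) (hemp : HEmpU hc hRa hν h0 hgen hBG b) (q : ℕ) :
    IdealSheafData.IsPermissible ((unitTowerU hc hRa hν h0 hgen hBG b hemp).centreIdeal q) :=
  (upTower hc hRa hν h0 b).isPermissible_centreIdeal_localize (c b).pt _ (isPermissible_centreIdeal_upTower hc hRa hν h0 b _)

end Unit

end Summit.ResolutionOfSingularities.ResolutionOfSingularities.Theorems.SigmaMaxModificationsCorridor3.Moving.Seg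

end
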